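import Mathlib
import HarnessLib
import Literature.MathematicalPhysics.QuantumLattice.HubbardGrandCanonicalDensity
import Summits.HubbardSuperconductivity.HubbardSuperconductivity.Theorems.WeakCouplingBCSWcbcsBcsConstructionRegularEquationOfState
import Summits.HubbardSuperconductivity.HubbardSuperconductivity.Theorems.ChiralWindowCwChiralConstructionFreeBandLimit
import Summits.HubbardSuperconductivity.HubbardSuperconductivity.Theorems.ChiralWindowCwChannelInfContinuousFilling

/-!
# WeakCouplingBCS / crux `WcbcsBcsConstruction` — stub (Bgen): the generic free/interacting density sandwich

Line `ladder-scale-certified-chain` (rev c5-1) of crux stmt-HubbardSuperconductivity-2010, registered stub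
`stub_gcDensitySandwichFree`. Write `n_L(U,μ) = Re ω₀[hubbardTorusWith 2 (L+1) 1 U μ](N)/(L+1)²` for the tracial
grand-canonical ground-state density per site of the 2D Hubbard torus, `E_L(U,y) = E₀(hubbardTorusWith 2 (L+1) 1 U y)`,
`V_L = (L+1)²`, `e(U,y) = lim_L E_L(U,y)/V_L` (`wcbcs_eos_tendsto`, `limUnder` form) and
`F = KohnLuttinger.filling (squareDispersion 1 0)` for the free continuum filling. For every `U ≥ 0`, every `μ` and
every step `r > 0`:

  `limsup_L n_L(U,μ) ≤ F(μ+r) + U/r`  and  `F(μ-r) - U/r ≤ liminf_L n_L(U,μ)`.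

Proof: Griffiths' slope sandwich at finite volume `(E_L(μ-r) - E_L(μ))/r ≤ Re ω(N) ≤ (E_L(μ) - E_L(μ+r))/r`
(`gcNumber_torus_mem_Icc_slope`) per unit volume; both bounding sequences converge (`wcbcs_eos_tendsto`), and the
density lies in `[0, 2]` (`gcDensity_torus_mem_Icc`), so `limsup n ≤ (e(U,μ) - e(U,μ+r))/r` and
`(e(U,μ-r) - e(U,μ))/r ≤ liminf n`; the interaction sandwich `0 ≤ e(U,·) - e(0,·) ≤ U` (`wcbcs_eos_sub_free_mem_Icc`);
the free limit `e(0,·) = e₀` with `e₀' = -F` (`stub_freeBandLimit`, uniqueness of limits) and the mean value theorem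
with the monotone `F` (`monotone_filling`): `e₀(μ) - e₀(μ+r) ≤ r F(μ+r)`, `r F(μ-r) ≤ e₀(μ-r) - e₀(μ)`.

Griffiths, J. Math. Phys. 5 (1964) 1215; Koma–Tasaki, J. Stat. Phys. 76 (1994) §1. No definition is introduced.
-/

set_option linter.dupNamespace false

namespace Summit.HubbardSuperconductivity.HubbardSuperconductivity.Theorems

open Literature.MathematicalPhysics.QuantumLattice Literature.Probability.LatticeModels MeasureTheory Matrix Filter
open scoped Topology

/-- **Mean value bounds for an antiderivative of a monotone function.** If `e₀' = -F` everywhere and `F` is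
monotone, then for `r > 0`: `e₀ μ - e₀ (μ + r) ≤ r F(μ + r)` and `r F(μ - r) ≤ e₀ (μ - r) - e₀ μ` (Lagrange's
mean value theorem on `[μ, μ+r]` and `[μ-r, μ]`). [folklore] -/
theorem wcbcs_freeBand_slope_sandwich {e₀ F : ℝ → ℝ} (hd : ∀ x, HasDerivAt e₀ (-F x) x) (hF : Monotone F)
    (μ : ℝ) {r : ℝ} (hr : 0 < r) :
    e₀ μ - e₀ (μ + r) ≤ r * F (μ + r) ∧ r * F (μ - r) ≤ e₀ (μ - r) - e₀ μ := by
  have hc : ∀ a b : ℝ, ContinuousOn e₀ (Set.Icc a b) := fun a b x _ =>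
    (hd x).continuousAt.continuousWithinAt
  constructor
  · obtain ⟨c, hc₁, hc₂⟩ := exists_hasDerivAt_eq_slope e₀ (fun x => -F x) (by linarith : μ < μ + r)
      (hc _ _) (fun x _ => hd x)
    rw [add_sub_cancel_left, eq_div_iff hr.ne'] at hc₂
    have hFc : F c ≤ F (μ + r) := hF hc₁.2.le
    calc e₀ μ - e₀ (μ + r) = r * F c := by linarith
      _ ≤ r * F (μ + r) := mul_le_mul_of_nonneg_left hFc hr.le
  · obtain ⟨c, hc₁, hc₂⟩ := exists_hasDerivAt_eq_slope e₀ (fun x => -F x) (by linarith : μ - r < μ)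
      (hc _ _) (fun x _ => hd x)
    rw [sub_sub_cancel, eq_div_iff hr.ne'] at hc₂
    have hFc : F (μ - r) ≤ F c := hF hc₁.1.le
    calc r * F (μ - r) ≤ r * F c := mul_le_mul_of_nonneg_left hFc hr.le
      _ = e₀ (μ - r) - e₀ μ := by linarith

/-- **`limsup`/`liminf` of a density sandwiched by Griffiths slopes.** Sequences `N_L` (numbers), `E_L, E⁺_L, E⁻_L`
(energies at `μ`, `μ + r`, `μ - r`) with `(E⁻_L - E_L)/r ≤ N_L ≤ (E_L - E⁺_L)/r`, densities `N_L/V_L ∈ [0, 2]`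
(`V_L = (L+1)²`), and convergent slopes per unit volume `(E_L/V_L - E⁺_L/V_L)/r → A ≤ A'`,
`(E⁻_L/V_L - E_L/V_L)/r → B ≥ B'`: then `limsup_L N_L/V_L ≤ A'` and `B' ≤ liminf_L N_L/V_L`. [folklore] -/
theorem wcbcs_limsup_liminf_of_sandwich {N E Ep Em : ℕ → ℝ} {A B A' B' r : ℝ}
    (ha : Tendsto (fun L : ℕ => (E L / ((L + 1 : ℕ) : ℝ) ^ 2 - Ep L / ((L + 1 : ℕ) : ℝ) ^ 2) / r)
      atTop (𝓝 A))
    (hb : Tendsto (fun L : ℕ => (Em L / ((L + 1 : ℕ) : ℝ) ^ 2 - E L / ((L + 1 : ℕ) : ℝ) ^ 2) / r)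
      atTop (𝓝 B))
    (hn : ∀ L : ℕ, N L ∈ Set.Icc ((Em L - E L) / r) ((E L - Ep L) / r))
    (hbd : ∀ L : ℕ, N L / ((L + 1 : ℕ) : ℝ) ^ 2 ∈ Set.Icc (0 : ℝ) 2) (hA : A ≤ A') (hB : B' ≤ B) :
    limsup (fun L : ℕ => N L / ((L + 1 : ℕ) : ℝ) ^ 2) atTop ≤ A' ∧
      B' ≤ liminf (fun L : ℕ => N L / ((L + 1 : ℕ) : ℝ) ^ 2) atTop := by
  have hb1 : IsBoundedUnder (· ≥ ·) atTop (fun L : ℕ => N L / ((L + 1 : ℕ) : ℝ) ^ 2) :=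
    isBoundedUnder_of ⟨0, fun L => (hbd L).1⟩
  have hb2 : IsBoundedUnder (· ≤ ·) atTop (fun L : ℕ => N L / ((L + 1 : ℕ) : ℝ) ^ 2) :=
    isBoundedUnder_of ⟨2, fun L => (hbd L).2⟩
  have hup : ∀ L : ℕ, N L / ((L + 1 : ℕ) : ℝ) ^ 2 ≤
      (E L / ((L + 1 : ℕ) : ℝ) ^ 2 - Ep L / ((L + 1 : ℕ) : ℝ) ^ 2) / r := fun L => by
    have hV : (0 : ℝ) < ((L + 1 : ℕ) : ℝ) ^ 2 := by positivity
    calc N L / ((L + 1 : ℕ) : ℝ) ^ 2 ≤ (E L - Ep L) / r / ((L + 1 : ℕ) : ℝ) ^ 2 :=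
          div_le_div_of_nonneg_right (hn L).2 hV.le
      _ = (E L / ((L + 1 : ℕ) : ℝ) ^ 2 - Ep L / ((L + 1 : ℕ) : ℝ) ^ 2) / r := by ring
  have hlo : ∀ L : ℕ, (Em L / ((L + 1 : ℕ) : ℝ) ^ 2 - E L / ((L + 1 : ℕ) : ℝ) ^ 2) / r ≤
      N L / ((L + 1 : ℕ) : ℝ) ^ 2 := fun L => by
    have hV : (0 : ℝ) < ((L + 1 : ℕ) : ℝ) ^ 2 := by positivity
    calc (Em L / ((L + 1 : ℕ) : ℝ) ^ 2 - E L / ((L + 1 : ℕ) : ℝ) ^ 2) / r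
          = (Em L - E L) / r / ((L + 1 : ℕ) : ℝ) ^ 2 := by ring
      _ ≤ N L / ((L + 1 : ℕ) : ℝ) ^ 2 := div_le_div_of_nonneg_right (hn L).1 hV.le
  constructor
  · calc limsup (fun L : ℕ => N L / ((L + 1 : ℕ) : ℝ) ^ 2) atTop
          ≤ limsup (fun L : ℕ => (E L / ((L + 1 : ℕ) : ℝ) ^ 2 - Ep L / ((L + 1 : ℕ) : ℝ) ^ 2) / r) atTop :=
            limsup_le_limsup (Eventually.of_forall hup) hb1.isCoboundedUnder_le ha.isBoundedUnder_le
      _ = A := ha.limsup_eq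
      _ ≤ A' := hA
  · calc B' ≤ B := hB
      _ = liminf (fun L : ℕ => (Em L / ((L + 1 : ℕ) : ℝ) ^ 2 - E L / ((L + 1 : ℕ) : ℝ) ^ 2) / r) atTop :=
            hb.liminf_eq.symm
      _ ≤ liminf (fun L : ℕ => N L / ((L + 1 : ℕ) : ℝ) ^ 2) atTop :=
            liminf_le_liminf (Eventually.of_forall hlo) hb.isBoundedUnder_ge hb2.isCoboundedUnder_ge

/-- **Stub (Bgen) — the generic free/interacting density sandwich** (registered stub `stub_gcDensitySandwichFree`
of crux stmt-HubbardSuperconductivity-2010, line `ladder-scale-certified-chain`, rev c5-1). For every `U ≥ 0`, every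
`μ` and every step `r > 0`: `limsup_L n_L(U,μ) ≤ F(μ+r) + U/r` and `F(μ-r) - U/r ≤ liminf_L n_L(U,μ)`, with
`F = KohnLuttinger.filling (squareDispersion 1 0)` the free filling and
`n_L(U,μ) = Re ω₀[hubbardTorusWith 2 (L+1) 1 U μ](N)/(L+1)²`. Griffiths' slope sandwich at finite volume
(`gcNumber_torus_mem_Icc_slope`) per unit volume, the limits `E_L/V_L → e(U,·)` (`wcbcs_eos_tendsto`), the interaction
sandwich `0 ≤ e(U,·) - e(0,·) ≤ U` (`wcbcs_eos_sub_free_mem_Icc`), the free limit `e(0,·) = e₀`, `e₀' = -F`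
(`stub_freeBandLimit`) and the mean value theorem with the monotone `F` (`monotone_filling`); densities lie in
`[0, 2]` (`gcDensity_torus_mem_Icc`). [cite: KomaTasaki1994, §1] -/
theorem stub_gcDensitySandwichFree :
    ∀ U μ r : ℝ, 0 ≤ U → 0 < r →
      limsup (fun L : ℕ => ((hubbardTorusWith 2 (L + 1) 1 U μ).groundStateFunctional
          totalNumber).re / ((L + 1 : ℕ) : ℝ) ^ 2) atTop ≤
        KohnLuttinger.filling (squareDispersion 1 0) (μ + r) + U / r ∧
      KohnLuttinger.filling (squareDispersion 1 0) (μ - r) - U / r ≤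
        liminf (fun L : ℕ => ((hubbardTorusWith 2 (L + 1) 1 U μ).groundStateFunctional
          totalNumber).re / ((L + 1 : ℕ) : ℝ) ^ 2) atTop := by
  intro U μ r hU hr
  -- the free limit `e₀`, `e₀' = -F`, and `e(0,·) = e₀` by uniqueness of limits
  obtain ⟨e₀, hlim₀, hder₀, -, -, -⟩ := stub_freeBandLimit
  obtain ⟨hmvt₁, hmvt₂⟩ := wcbcs_freeBand_slope_sandwich hder₀ monotone_filling μ hr
  have he0 : ∀ y : ℝ, limUnder atTop (fun L : ℕ => (hubbardTorusWith 2 (L + 1) 1 0 y).groundEnergy /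
      ((L + 1 : ℕ) : ℝ) ^ 2) = e₀ y := fun y => (hlim₀ y).limUnder_eq
  -- the interaction sandwich in the limit
  have hUμ := (wcbcs_eos_sub_free_mem_Icc hU μ).2
  have h0p := (wcbcs_eos_sub_free_mem_Icc hU (μ + r)).1
  have h0m := (wcbcs_eos_sub_free_mem_Icc hU (μ - r)).1
  rw [he0] at hUμ h0p h0m
  refine wcbcs_limsup_liminf_of_sandwich
    (((wcbcs_eos_tendsto U μ).sub (wcbcs_eos_tendsto U (μ + r))).div_const r)
    (((wcbcs_eos_tendsto U (μ - r)).sub (wcbcs_eos_tendsto U μ)).div_const r)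
    (fun L => gcNumber_torus_mem_Icc_slope (L + 1) 1 U μ hr)
    (fun L => gcDensity_torus_mem_Icc (L + 1) 1 U μ) ?_ ?_
  · -- `(e(U,μ) - e(U,μ+r))/r ≤ F(μ+r) + U/r`
    rw [div_le_iff₀ hr, add_mul, div_mul_cancel₀ U hr.ne']
    linarith
  · -- `F(μ-r) - U/r ≤ (e(U,μ-r) - e(U,μ))/r`
    rw [le_div_iff₀ hr, sub_mul, div_mul_cancel₀ U hr.ne']
    linarith

end Summit.HubbardSuperconductivity.HubbardSuperconductivity.Theorems
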